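import Mathlib
import Literature.AlgebraicGeometry.Resolution.Blowups
import Literature.AlgebraicGeometry.Resolution.BlowupsLocal
import Literature.AlgebraicGeometry.Resolution.AffineBlowupUniversal
import Literature.AlgebraicGeometry.Resolution.IdealSheafLemmas
import Literature.AlgebraicGeometry.Resolution.ResolutionGlue
import Summits.ResolutionOfSingularities.ResolutionOfSingularities.Theorems.WildQuotientsWildQuotientResolutionBlowupLocalExit

/-!
# Discharging the local hypothesis of the exit on an affine piece: transport of affine blowing ups

Crux stmt-ResolutionOfSingularities-15640 (`WildQuotients.WildQuotientResolution`), line `Sketch`;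
programme V3U of CHAIN w45c v5, RULING v5.1 row V3U-F-W (res-L1-w45c-stub-3) — the `hU`/`hP`
hypothesis «SOME blow-up of the piece along `𝓘|` is regular» of
`BlowupExit.hasResolution_of_isBlowup_local` (p484514) when the piece is (isomorphic to) an affine
scheme `Spec S` and `𝓘|` is the ideal sheaf of an ideal `J ⊆ S`. [OURS · L1 W4.5c] — generic glue,
NOT a statement of the manuscript.

* `isBlowup_affineBlowup_comp_specMap` — `Bl_J(Spec R) → Spec R ≅ Spec S` (along a ring
  isomorphism `φ : R ≃ S`) is a blow-up of `Spec S` along `J·φ = Ĩ_{φ(J)}`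
  (`IsBlowup.comp_iso` + `comap_ofIdealTop_SpecMap`).
* `isRegular_affineBlowup_map_ringEquiv` — hence `Bl_{φ(J)}(Spec S)` is regular iff `Bl_J(Spec R)`
  is (uniqueness of blow-ups); so a chart regularity proved for a PRESENTATION (e.g. V3U C4, the
  cone `k[X]/(PR − Q²)`) transfers to any isomorphic ring (the invariant ring `Γ(Y_a)`).
* `isRegular_of_le` — an open inside a regular open subscheme is regular (`hW` for `W_b ≤ X'[⊤, x_b²]`).
* `exists_isBlowup_regular_of_iso_spec` — for `e : Spec S ≅ P` and `𝓘` on `P` with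
  `𝓘.comap e.hom = Ĩ_J`, a regular `Bl_J(Spec S)` yields `∃ B p, IsBlowup p 𝓘 ∧ IsRegular B` — the
  literal shape of `hU`/`hP` in the E1 family (feed `e` from `BlowupExit.exists_iso_spec_pieceQuot`
  p486067 and `𝓘.comap … = Ĩ_J` from `comap_vanishingIdeal_of_isOpenImmersion` +
  `vanishingIdeal_eq_idealSheaf_of_isRadical` p485627).
-/

-- single-problem summit: the doubled namespace component `ResolutionOfSingularities` is forced
set_option linter.dupNamespace false

noncomputable section

universe u

open CategoryTheory AlgebraicGeometry TopologicalSpace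
open Literature.AlgebraicGeometry.Resolution

namespace Summit.ResolutionOfSingularities.ResolutionOfSingularities.Theorems.WildQuotientResolution.BlowupExit

/-- **Transport of the affine blowing up along a ring isomorphism**: for `φ : R ≃+* S`,
`Bl_J(Spec R) → Spec R → Spec S` (the second arrow `Spec φ⁻¹`, an isomorphism) is a blow-up of
`Spec S` along the ideal sheaf of `φ(J)`. [cite: GortzWedhorn2020, Prop. 13.91] -/
theorem isBlowup_affineBlowup_comp_specMap {R S : Type u} [CommRing R] [CommRing S]
    (φ : R ≃+* S) (J : Ideal R) :
    IsBlowup (affineBlowup.π J ≫ Spec.map (CommRingCat.ofHom (φ.symm : S →+* R)))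
      (affineBlowup.idealSheaf (J.map (φ : R →+* S))) := by
  let e : Spec (CommRingCat.of R) ≅ Spec (CommRingCat.of S) :=
    { hom := Spec.map (CommRingCat.ofHom (φ.symm : S →+* R))
      inv := Spec.map (CommRingCat.ofHom (φ : R →+* S))
      hom_inv_id := by
        rw [← Spec.map_comp, ← CommRingCat.ofHom_comp]
        have : (φ.symm : S →+* R).comp (φ : R →+* S) = RingHom.id R :=
          RingHom.ext fun r => φ.symm_apply_apply r
        rw [this, CommRingCat.ofHom_id, Spec.map_id]
      inv_hom_id := by
        rw [← Spec.map_comp, ← CommRingCat.ofHom_comp]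
        have : (φ : R →+* S).comp (φ.symm : S →+* R) = RingHom.id S :=
          RingHom.ext fun s => φ.apply_symm_apply s
        rw [this, CommRingCat.ofHom_id, Spec.map_id] }
  have h := (affineBlowup.isBlowup J).comp_iso e
  have he : (affineBlowup.idealSheaf J).comap e.inv = affineBlowup.idealSheaf (J.map (φ : R →+* S)) := by
    change (affineBlowup.idealSheaf J).comap (Spec.map (CommRingCat.ofHom (φ : R →+* S))) = _
    rw [affineBlowup.idealSheaf, comap_ofIdealTop_SpecMap]
    rfl
  rw [he] at h
  exact h

/-- **Regularity of the affine blowing up transfers along ring isomorphisms**: with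
`φ : R ≃+* S`, if `Bl_J(Spec R)` is regular then so is `Bl_{φ(J)}(Spec S)` (both are blow-ups of
`Spec S` along the same ideal sheaf, `IsBlowup.unique`). [folklore] -/
theorem isRegular_affineBlowup_map_ringEquiv {R S : Type u} [CommRing R] [CommRing S]
    (φ : R ≃+* S) (J : Ideal R) (hreg : Scheme.IsRegular (affineBlowup J)) :
    Scheme.IsRegular (affineBlowup (J.map (φ : R →+* S))) := by
  obtain ⟨e, -, -⟩ := (isBlowup_affineBlowup_comp_specMap φ J).unique
    (affineBlowup.isBlowup (J.map (φ : R →+* S)))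
  exact Scheme.IsRegular.of_iso e.hom hreg

/-- **Discharging «some blow-up of the piece along `𝓘|` is regular» on an affine piece.** If
`e : Spec S ≅ P` identifies the piece with an affine scheme under which `𝓘` corresponds to the
ideal sheaf of `J ⊆ S` (`𝓘.comap e.hom = Ĩ_J`), and `Bl_J(Spec S)` is regular, then
`∃ B p, IsBlowup p 𝓘 ∧ IsRegular B` (namely `Bl_J(Spec S) → Spec S ≅ P`). This is the `hU`/`hP`
input of `BlowupExit.hasResolution_of_isBlowup_local{,_of_isOpenImmersion,ly_regular}`.
[folklore] -/
theorem exists_isBlowup_regular_of_iso_spec {S : Type u} [CommRing S] {P : Scheme.{u}}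
    (e : Spec (CommRingCat.of S) ≅ P) (𝓘 : P.IdealSheafData) (J : Ideal S)
    (h𝓘 : 𝓘.comap e.hom = affineBlowup.idealSheaf J)
    (hreg : Scheme.IsRegular (affineBlowup J)) :
    ∃ (B : Scheme.{u}) (p : B ⟶ P), IsBlowup p 𝓘 ∧ Scheme.IsRegular B := by
  refine ⟨affineBlowup J, affineBlowup.π J ≫ e.hom, ?_, hreg⟩
  have h := (affineBlowup.isBlowup J).comp_iso e
  rwa [← h𝓘, ← Scheme.IdealSheafData.comap_comp, e.inv_hom_id,
    Scheme.IdealSheafData.comap_id] at h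

/-- **The same with a presentation**: if moreover `J = J₀.map φ` for a ring isomorphism
`φ : R ≃+* S` (e.g. a presentation `R` of the piece's ring `S` on which the blow-up charts were
computed) and `Bl_{J₀}(Spec R)` is regular, then again `∃ B p, IsBlowup p 𝓘 ∧ IsRegular B`.
[folklore] -/
theorem exists_isBlowup_regular_of_iso_spec_of_ringEquiv {R S : Type u} [CommRing R] [CommRing S]
    {P : Scheme.{u}} (e : Spec (CommRingCat.of S) ≅ P) (𝓘 : P.IdealSheafData) (φ : R ≃+* S)
    (J₀ : Ideal R) (h𝓘 : 𝓘.comap e.hom = affineBlowup.idealSheaf (J₀.map (φ : R →+* S)))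
    (hreg : Scheme.IsRegular (affineBlowup J₀)) :
    ∃ (B : Scheme.{u}) (p : B ⟶ P), IsBlowup p 𝓘 ∧ Scheme.IsRegular B :=
  exists_isBlowup_regular_of_iso_spec e 𝓘 (J₀.map (φ : R →+* S)) h𝓘
    (isRegular_affineBlowup_map_ringEquiv φ J₀ hreg)

/-- **An open subscheme of a regular open subscheme is regular** (for `hW`/`hQ` of the exit when
the regular piece is given inside a regular chart, e.g. `W_b ≤ X'[⊤, x_b²]`). [folklore] -/
theorem isRegular_of_le {X : Scheme.{u}} {U B : X.Opens} (h : U ≤ B)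
    (hB : Scheme.IsRegular (B : Scheme.{u})) : Scheme.IsRegular (U : Scheme.{u}) := by
  intro x
  have hx : U.ι.base x ∈ B := h x.2
  haveI := isRegularLocalRing_stalk_of_mem B hB (U.ι.base x) hx
  exact IsRegularLocalRing.of_ringEquiv (asIso (U.ι.stalkMap x)).commRingCatIsoToRingEquiv

end Summit.ResolutionOfSingularities.ResolutionOfSingularities.Theorems.WildQuotientResolution.BlowupExit

end
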